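import Summits.QuantumFields.YangMills.Theorems.LuscherReductionDressedRitzPolyakovLiftEuclideanCurrency
import Summits.QuantumFields.YangMills.Theorems.LuscherReductionDressedRitzPolyakovLiftRawVacuum
import Summits.QuantumFields.YangMills.Theorems.FemtoTransferGapEigenbasis
import HarnessLib

/-!
# Route `LuscherReduction`, item `DressedRitz` (stmt-QuantumFields-20205), line «polyakovlift» r5 — the a-priori GAP BOUND for every channel:
# `⟨u, K_β u⟩ ≤ λ₁ ‖u‖²` for any physical `u ⊥ φ` (raw vacuum `φ`); hence every dressed channel vector has Rayleigh quotient `≤ λ₁`, every connected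
# correlator has `corr_{2m+1,ii} ≤ (λ₁/λ₀)·corr_{2m,ii}`, and the UPPER half of (o5) for channel `0` follows from the FIRST-GAP comparison alone

Support module (LEAD prover ym-lead-20205-polyakovlift g0; `--supports stmt-QuantumFields-20205`, helper).  Courant–Fischer at level 1 (tree
`exists_isPhys_eigenseq`: domination `ψ ⊥ e₀ ⇒ qform ψ ψ ≤ λ₁‖ψ‖²`), with `e₀ = ±φ` for a raw vacuum (`PolyakovLift.eq_smul`, `sq_eq_one_and_eq`):

* `form_le_levelOne_of_orth` — `IsRawVacuum β φ`, `IsPhys ψ`, `⟨φ,ψ⟩ = 0` ⟹ `⟨ψ, K_βψ⟩ ≤ λ₁·⟨ψ,ψ⟩` (`λ₁ = levelValue su2Rep L β 1`);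
* `dressedLiftFamily_form_le_levelOne` — for the dressed lift family: `⟨u_i, K_β u_i⟩ ≤ λ₁‖u_i‖²` (every channel's effective mass ≥ the true gap);
* `corr_odd_le_gap_mul` — `corr β φ G (2m+1) i i ≤ (λ₁/λ₀)·corr β φ G (2m) i i` for physical insertions;
* ★ `o5_upper_channelZero_of_firstGap` — if `λ₁(β,L)·μ₀(B) ≤ e^{Cλ²/L}·μ₁(B)·λ₀(β,L)` (one-loop universality of the FIRST gap, an S-UNIV/RED-type level
  statement) then the upper (o5) inequality for the channel with target level `1` holds for EVERY physical `u ⊥ φ` — no eigenvector control needed.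
  (With the symmetry bookkeeping of infvol-p1 — channels in an O_h-isotype `Γ` are orthogonal to all eigenvectors of other isotypes — the same argument gives
  the upper half of (o5) for the LOWEST channel of each isotype from the sector's first-gap comparison; not typed here.)

HONEST FRAMING: fixed-lattice functional analysis on the conditional femto rung R2b1; the first-gap comparison itself is OPEN RG content; nothing here bears on
infinite volume, the continuum limit or the Clay gap.  References: Reed–Simon IV Thm XIII.1 [cite: ReedSimonIV1978, Thm. XIII.1–2]; M. Lüscher, U. Wolff,
NPB 339 (1990) 222 [cite: LuscherWolff1990].
-/

set_option autoImplicit false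

noncomputable section

open MeasureTheory Filter Topology Real
open Literature.MathematicalPhysics.QuantumFieldTheory (GaugeConfig Site gaugeTransform)
open scoped BigOperators

namespace Summit.QuantumFields.YangMills.Theorems.FemtoTransferGap.PolyakovLift

open Summit.QuantumFields.YangMills.Theorems.FemtoTransferGap
open Summit.QuantumFields.YangMills.Theorems.FemtoTransferGap.VacDict

variable {L : ℕ} [NeZero L]

/-- ★ **Courant–Fischer at level 1, read at a raw vacuum**: `⟨ψ, K_βψ⟩ ≤ λ₁⟨ψ,ψ⟩` for physical `ψ` with `⟨φ,ψ⟩ = 0`, `φ` a raw vacuum, `β > 0`.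
[cite: ReedSimonIV1978, Thm. XIII.1–2] -/
theorem form_le_levelOne_of_orth {β : ℝ} (hβ : 0 < β) {φ : GaugeConfig 3 L SU2 → ℝ} (hφ : IsRawVacuum β φ)
    {ψ : GaugeConfig 3 L SU2 → ℝ} (hψ : IsPhys ψ) (horth : l2 φ ψ = 0) :
    l2 ψ (transferApply β ψ) ≤ levelValue su2Rep L β 1 * l2 ψ ψ := by
  obtain ⟨e, hon, heig, hdom, -⟩ := exists_isPhys_eigenseq (L := L) hβ
  set f₀ : GaugeConfig 3 L SU2 → ℝ := ((e 0 : physSubmodule L) : GaugeConfig 3 L SU2 → ℝ) with hf₀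
  have hf₀vac : IsRawVacuum β f₀ := ⟨(e 0).2, by simpa using hon 0 0, heig 0⟩
  -- both `φ` and `f₀` are `±Ω` for a vacuum package `Ω`
  obtain ⟨Ω, θ, c, hV, hc, hcle⟩ := exists_isVacuum (L := L) β
  obtain ⟨hsqφ, -⟩ := sq_eq_one_and_eq hV hφ
  have heφ := eq_smul hV hφ
  have hef := eq_smul hV hf₀vac
  have hΩψ : l2 (Ω : GaugeConfig 3 L SU2 → ℝ) ψ = 0 := by
    have h1 : l2 φ ψ = l2 φ (Ω : GaugeConfig 3 L SU2 → ℝ) * l2 (Ω : GaugeConfig 3 L SU2 → ℝ) ψ := by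
      conv_lhs => rw [heφ]
      rw [l2_smul_left]
    rw [horth] at h1
    have ha : l2 φ (Ω : GaugeConfig 3 L SU2 → ℝ) ≠ 0 := by
      intro h0; rw [h0] at hsqφ; norm_num at hsqφ
    exact (mul_eq_zero.mp h1.symm).resolve_left ha
  have hfψ : l2 ψ f₀ = 0 := by
    rw [l2_comm, hef, l2_smul_left, hΩψ, mul_zero]
  have h := hdom 1 ψ hψ (fun i hi => by
    have : i = 0 := by omega
    subst this; exact hfψ)
  rwa [qform_eq_l2_transferApply] at h

/-- Every dressed channel vector has Rayleigh quotient `≤ λ₁`: `⟨u_i, K_βu_i⟩ ≤ λ₁‖u_i‖²`. [cite: LuscherWolff1990] -/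
theorem dressedLiftFamily_form_le_levelOne {k : ℕ} {β : ℝ} (hβ : 0 < β) {φ : GaugeConfig 3 L SU2 → ℝ} (hφ : IsRawVacuum β φ)
    {g : Fin k → (GaugeConfig 3 1 SU2 → ℝ)} (hg : ∀ i, IsPhys (g i)) (i : Fin k) :
    l2 (dressedLiftFamily β φ g i) (transferApply β (dressedLiftFamily β φ g i)) ≤
      levelValue su2Rep L β 1 * l2 (dressedLiftFamily β φ g i) (dressedLiftFamily β φ g i) := by
  rw [dressedLiftFamily_apply]
  exact form_le_levelOne_of_orth hβ hφ (isPhys_dressedLiftVec β hφ.1 (hg i)) (l2_vac_dressedLiftVec β hφ (hg i))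

/-- In Euclidean currency: `corr_{2m+1,ii} ≤ (λ₁/λ₀)·corr_{2m,ii}` for physical insertions at a raw vacuum. [cite: LuscherWolff1990] -/
theorem corr_odd_le_gap_mul {k : ℕ} {β : ℝ} (hβ : 0 < β) {φ : GaugeConfig 3 L SU2 → ℝ} (hφ : IsRawVacuum β φ)
    {G : Fin k → (GaugeConfig 3 L SU2 → ℝ)} (hG : ∀ i, IsPhys (G i)) (m : ℕ) (i : Fin k) :
    corr β φ G (2 * m + 1) i i ≤ levelValue su2Rep L β 1 / levelValue su2Rep L β 0 * corr β φ G (2 * m) i i := by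
  have hl0 : 0 < levelValue su2Rep L β 0 := levelValue_su2Rep_pos hβ 0
  set v := (transferApply (L := L) β)^[m] (OpPlat.ins φ (G i)) with hv
  have hvP : IsPhys v := isPhys_iterate_transferApply β (OpPlat.isPhys_ins hφ.1 (hG i)) m
  have hvorth : l2 φ v = 0 := by
    rw [hv, l2_vac_iterate β hφ.1 (OpPlat.isPhys_ins hφ.1 (hG i)) hφ.2.2 m, l2_vac_ins hφ.1 (hG i) hφ.2.1, mul_zero]
  have h := form_le_levelOne_of_orth hβ hφ hvP hvorth
  rw [hv, corr_dressed_form hβ hφ.1 hG m i i, corr_dressed_norm hβ hφ.1 hG m i i] at h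
  -- cancel `λ₀^{2m+1}`
  rw [div_mul_eq_mul_div, le_div_iff₀ hl0]
  have hP : 0 < levelValue su2Rep L β 0 ^ (2 * m) := pow_pos hl0 _
  have h' : levelValue su2Rep L β 0 ^ (2 * m) * (corr β φ G (2 * m + 1) i i * levelValue su2Rep L β 0) ≤
      levelValue su2Rep L β 0 ^ (2 * m) * (levelValue su2Rep L β 1 * corr β φ G (2 * m) i i) := by
    calc levelValue su2Rep L β 0 ^ (2 * m) * (corr β φ G (2 * m + 1) i i * levelValue su2Rep L β 0)
        = levelValue su2Rep L β 0 ^ (2 * m + 1) * corr β φ G (2 * m + 1) i i := by rw [pow_succ]; ring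
      _ ≤ levelValue su2Rep L β 1 * (levelValue su2Rep L β 0 ^ (2 * m) * corr β φ G (2 * m) i i) := h
      _ = levelValue su2Rep L β 0 ^ (2 * m) * (levelValue su2Rep L β 1 * corr β φ G (2 * m) i i) := by ring
  exact le_of_mul_le_mul_left h' hP

/-- ★ **The upper half of (o5) for channel 0 from the FIRST-GAP comparison alone**: if `λ₁μ₀ ≤ e^{Cλ²/L}·μ₁λ₀` then for every physical `u ⊥ φ`:
`⟨u,K_βu⟩·μ₀ ≤ e^{Cλ²/L}·(μ₁λ₀)·‖u‖²` — the (o5) upper inequality of `DynamicCoreClauses` at the index with `(i:ℕ)+1 = 1`. [cite: Luscher1983, §3] -/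
theorem o5_upper_channelZero_of_firstGap {β : ℝ} (hβ : 0 < β) (hB : 0 ≤ oneSiteCoupling β L) {φ : GaugeConfig 3 L SU2 → ℝ}
    (hφ : IsRawVacuum β φ) (C : ℝ)
    (hgap : levelValue su2Rep L β 1 * levelValue su2Rep 1 (oneSiteCoupling β L) 0 ≤
      Real.exp (C * luscherLambda β L ^ 2 / L) * (levelValue su2Rep 1 (oneSiteCoupling β L) 1 * levelValue su2Rep L β 0))
    {u : GaugeConfig 3 L SU2 → ℝ} (hu : IsPhys u) (horth : l2 φ u = 0) :
    l2 u (transferApply β u) * levelValue su2Rep 1 (oneSiteCoupling β L) 0 ≤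
      Real.exp (C * luscherLambda β L ^ 2 / L) * (levelValue su2Rep 1 (oneSiteCoupling β L) (0 + 1) * levelValue su2Rep L β 0) *
        l2 u u := by
  have h := form_le_levelOne_of_orth hβ hφ hu horth
  have hn : 0 ≤ l2 u u := l2_self_nonneg _
  have hμ : 0 ≤ levelValue su2Rep 1 (oneSiteCoupling β L) 0 := levelValue_su2Rep_nonneg 1 hB 0
  calc l2 u (transferApply β u) * levelValue su2Rep 1 (oneSiteCoupling β L) 0
      ≤ levelValue su2Rep L β 1 * l2 u u * levelValue su2Rep 1 (oneSiteCoupling β L) 0 := mul_le_mul_of_nonneg_right h hμ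
    _ = levelValue su2Rep L β 1 * levelValue su2Rep 1 (oneSiteCoupling β L) 0 * l2 u u := by ring
    _ ≤ Real.exp (C * luscherLambda β L ^ 2 / L) * (levelValue su2Rep 1 (oneSiteCoupling β L) 1 * levelValue su2Rep L β 0) * l2 u u :=
        mul_le_mul_of_nonneg_right hgap hn
    _ = _ := by norm_num

end Summit.QuantumFields.YangMills.Theorems.FemtoTransferGap.PolyakovLift

end
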